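/-
Copyright (c) 2026 the pub-hodgecm-mathlib formalisation cell (harness21).  Prover seat hodgecm-mathlib-R90-C14-p02 (g0), R90-TF section S8 «ContSpec-n½» (S8 dealer
R90-CS-plan (g2), deal S8-R30 2026-09-04T22:09:57Z «#2 letter-chain census, G side»; file F2 of the census `R90/S8/CENSUS-sock2-chain.R90-C14-p02-g0.md` 0a9019c1af1f8ec8):
the G-SIDE-ONLY post-closure step of socket #2 — an irreducible inside the closed span of the character lines AND the `πⁿ`-blocks is one-dimensional or a `πⁿ(ξ)`.
-/
import Summits.HodgeConjecture.HodgeConjecture.Theorems.R90S8OneDimOfLeClosureSupLines   -- ★ p861683 «p11» `finrank_eq_one_of_le_topologicalClosure_iSup`; brings ★ p861655 «p09», ★ #7, ★ `AutomorphicCharacter.lineSubrep`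
import Summits.HodgeConjecture.HodgeConjecture.Theorems.R90S8IsPiNOfEquiv                 -- ★ p861646 #9 `isPiN_of_areUnitarilyEquivalent`; brings ★ D-S8-2′ `IsPiN`, `charLine₃`
import HarnessLib

/-!
# S8 #2 road (G side, `U(Φ₃)`) — `R90S8ResGClassificationOfClosureU3`: an irreducible `P ≤ closure ((⨆_ψ ℂ·[ψ̄∘det]) ⊔ (⨆_k Πⁿ_k))` is ONE-DIMENSIONAL or carries the
# `πⁿ`-label of a block it meets — the step that turns a closed-span statement into socket #2's DISJUNCTION `P.IsOneDimensional ∨ ∃ ξ, IsPiN P μω hμu ξ`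

Track B ∕ K2-LIT, crux h413 = `stmt-HodgeConjecture-24833`, route of record `HCCMUnconditional`; cell `hodgecm-mathlib`, R90-TF programme, section S8 «ContSpec-n½»
(§13.9 residual spectrum), socket #2 `sock_S8_res_classification` of `Cruxes/H413/Lines/R90_S8_ResidualSpectrumU3B.lean` ED. 3 :171–:180 («every irreducible
`P ≤ L²_res(U(Φ₃))` is one-dimensional or `π_v = πⁿ(ξ_v)` for all `v`»).  This file is the G-side twin of the H-side step ★ «p11» ∘ ★ #8₂ (B :251–:259): on the H side
the closed span consists of LINES only; on the G side [Rogawski1990 §13.9 (ii) p. 229] adds the residual blocks `Πⁿ_ξ` at the middle pole `s = ½`, so the conclusion is a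
disjunction and the `πⁿ` disjunct is transported along a unitary equivalence by ★ #9.  THEOREMS ONLY (no `def`, no `instance`, no `notation`, no named-fact hypothesis, no
`sorry`; default heartbeats); lane `--supports stmt-HodgeConjecture-24833 --as helper` (count-neutral).  CLOSES NO SOCKET: the closed-span hypothesis `hle` is the conclusion
of the (to-be-typed) G-PRINT `R90S8ResGLeClosureOfLettersU3` (F1 of the census) and the block letter `hBk` («every irreducible closed `P′ ≤ Πⁿ_k` has `IsPiN P′ μω hμu (ξ k)`»)
is the content of the recommended socket `sock_S8_res_middleResidue_isPiN` (local identification of the middle residue, [Rogawski1990 §12.2 (3) p. 173]).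

THE MATHEMATICS ([Dixmier1977, §5.4, §13.1]; [BorelJacquet1979, §4.6]; [Rogawski1990, §13.9 p. 229]).  Let `π` be unitary, `(Λᵢ)ᵢ` closed invariant LINES, `(Π_k)_k` closed
invariant subspaces (no orthogonality assumed anywhere) and `P` topologically irreducible closed with `P ≤ closure ((⨆ᵢ Λᵢ) ⊔ (⨆_k Π_k))`.  Index the two families by
`ι ⊕ κ` (`Sum.elim`, Mathlib `iSup_sum`); ★ «p09» gives an index `s` and an irreducible closed `P′ ≤ B_s` with `P ≃ᵤ P′`.  If `s = inl i` then `P′ ≤ Λᵢ ≤ closure ⨆ Λ`, so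
`dim P′ = 1` (★ «p11» generic) and `dim P = 1` along the linear isomorphism underlying the equivalence (`LinearEquiv.finrank_eq`); if `s = inr k` we keep `(k, P′, P ≃ᵤ P′)`.
AUTOMORPHIC PRINT: `π = R` on `L²(G(K)\G(𝔸_K))` (★ `isUnitary_rightRegular`), `Λᵢ = ℂ·ψᵢ` (★ `lineSubrep`, ★ `finrank_lineSubrep`), a label predicate `Q P k` stable
under unitary equivalence and holding on every irreducible of `Π_k` ⟹ `P.IsOneDimensional ∨ ∃ k, Q P k`.  S8 PRINT: `𝒢 = cmDatum L 3 (qsForm L)`, `Λ = charLine₃` (★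
D-S8-2′, unfolds to `(cmDetChar …).lineSubrep μ` with the ★ `adelicGroupData_eq_cmDatum` instance seam of B :252–:254), `Q P k = IsPiN P μω hμu (ξ k)` (★ #9 transports it).
* §1 **`finrank_eq_one_or_exists_equiv_of_le_topologicalClosure_sup`** — generic Hilbert-space dichotomy (lines ⊔ blocks).
* §2 **`isOneDimensional_or_label_of_le_topologicalClosure_sup`** — any adelic datum, any equivalence-stable label.
* §3 **`isOneDimensional_or_exists_isPiN_of_le_topologicalClosure`** (index-keeping), **`isOneDimensional_or_exists_isPiN`** (socket #2's consequent VERBATIM) and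
  **`isOneDimensional_or_exists_isPiN_and`** (socket #2♯'s consequent shape: blocks indexed by the `ξ` satisfying a side predicate `R`, e.g. `R ξ = LHalfNeZero (ξ.bcη⁻¹ * μω)`).
HONEST LABEL: HC_CM is proved only modulo the 7 printed citations (2 remaining named inputs: hLiu418 = `stmt-HodgeConjecture-24832`, h413 = `stmt-HodgeConjecture-24833`) until
rung 0 closes; this file asserts no named fact, is conditional by construction on its visible binders (`hle`, `hBk`), and closes no socket; REL ≠ ★ ≠ BUILT; count-neutral.

## References
* [Rogawski1990] J. D. Rogawski, *Automorphic Representations of Unitary Groups in Three Variables*, Ann. of Math. Stud. 123 (1990), §13.9 p. 229 (i)–(ii), §12.2 (3) p. 173.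
* [Dixmier1977] J. Dixmier, *C\*-algebras* (North-Holland, 1977), §5.4, §13.1.
* [BorelJacquet1979] A. Borel, H. Jacquet, *Automorphic forms and automorphic representations*, Proc. Sympos. Pure Math. 33.1 (1979), §4.6.
-/

set_option autoImplicit false
set_option linter.dupNamespace false  -- the mandated namespace `…HodgeConjecture.HodgeConjecture.R90.S8` (LEAD #1 L1) repeats the summit's segment

noncomputable section

universe u

open MeasureTheory NumberField IsDedekindDomain
open Literature.NumberTheory.GaloisRepresentations
open Literature.NumberTheory.Automorphic.Arthur2013.Leaves.TECR
open Literature.NumberTheory.Automorphic Literature.NumberTheory.Automorphic.UnitaryGroup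
open Literature.NumberTheory.Rogawski1990
open Summit.HodgeConjecture.HodgeConjecture.Cruxes.H413.R90S8ResidualDefs (IsPiN charLine₃)

namespace Summit.HodgeConjecture.HodgeConjecture.R90.S8

open ContRepresentation

/-! ## §1 Generic: an irreducible inside the closed span of (lines ⊔ blocks) is a line or meets a block -/

section Generic

variable {G H : Type*} [Group G] [NormedAddCommGroup H] [InnerProductSpace ℂ H] [CompleteSpace H]
  {π : ContRepresentation ℂ G H}

/-- **Lines ⊔ blocks in ⟹ line, or equivalent to an irreducible of a block.**  For `π` unitary, LINES `Λ : ι → ClosedSubrep π` (`finrank = 1`), arbitrary closed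
invariant `Bk : κ → ClosedSubrep π` (no orthogonality assumed) and `P` topologically irreducible closed with `P ≤ closure ((⨆ i, Λ i) ⊔ (⨆ k, Bk k))`: either
`finrank ℂ P = 1`, or for some `k` there is an irreducible closed `P′ ≤ Bk k` with `P ≃ᵤ P′`.  (★ «p09» on the `ι ⊕ κ`-indexed family, Mathlib `iSup_sum`; the line
case by ★ «p11» generic at `P′ ≤ Λ i` and `LinearEquiv.finrank_eq`.) [cite: Dixmier1977, §5.4, §13.1] -/
theorem finrank_eq_one_or_exists_equiv_of_le_topologicalClosure_sup (hπ : π.IsUnitary) {ι κ : Type*} (Λ : ι → ClosedSubrep π)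
    (hΛ : ∀ i, Module.finrank ℂ (Λ i).toSubmodule = 1) (Bk : κ → ClosedSubrep π) (P : ClosedSubrep π) (hP : P.toContRep.IsTopIrreducible)
    (hle : P.toSubmodule ≤ ((⨆ i, (Λ i).toSubmodule) ⊔ ⨆ k, (Bk k).toSubmodule).topologicalClosure) :
    Module.finrank ℂ P.toSubmodule = 1 ∨
      ∃ (k : κ) (P' : ClosedSubrep π), P' ≤ Bk k ∧ P'.toContRep.IsTopIrreducible ∧ AreUnitarilyEquivalent P.toContRep P'.toContRep := by
  -- one `ι ⊕ κ`-indexed family of blocks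
  have hle' : P.toSubmodule ≤ (⨆ s : ι ⊕ κ, (Sum.elim Λ Bk s).toSubmodule).topologicalClosure := by
    rwa [iSup_sum]
  obtain ⟨s, P', hP'le, hP'irr, heq⟩ := exists_le_block_equiv_of_le_topologicalClosure_iSup hπ (Sum.elim Λ Bk) P hP hle'
  cases s with
  | inl i =>
    -- `P' ≤ Λ i ≤ closure (⨆ Λ)`: a line by «p11», transported along `P ≃ P'`
    refine Or.inl ?_
    have hP'Λ : P'.toSubmodule ≤ (⨆ j, (Λ j).toSubmodule).topologicalClosure :=
      ((ClosedSubrep.toSubmodule_le_iff.mpr hP'le).trans (le_iSup (fun j => (Λ j).toSubmodule) i)).trans (Submodule.le_topologicalClosure _)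
    have h1 : Module.finrank ℂ P'.toSubmodule = 1 := finrank_eq_one_of_le_topologicalClosure_iSup hπ Λ hΛ P' hP'irr hP'Λ
    obtain ⟨e, -⟩ := heq
    rw [e.toContinuousLinearEquiv.toLinearEquiv.finrank_eq]
    exact h1
  | inr k => exact Or.inr ⟨k, P', hP'le, hP'irr, heq⟩

end Generic

/-! ## §2 Automorphic, any datum: character lines ⊔ labelled blocks ⟹ one-dimensional or labelled -/

section Automorphic

variable {K : Type} [Field K] [NumberField K] {𝒢 : AdelicGroupData.{u} K}
  {μ : Measure 𝒢.automorphicQuotient} [𝒢.IsAutomorphicMeasure μ]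

/-- **Character lines ⊔ labelled blocks ⟹ one-dimensional or labelled.**  For any adelic datum `𝒢`, automorphic `μ`, characters `ψ : ι → 𝒢.AutomorphicCharacter`, closed
invariant blocks `Bk : κ → ClosedSubrep (R_μ)` and a label `Q P k` on discrete automorphic representations which is STABLE under unitary equivalence (`hQ`, the shape
of ★ #9) and holds on every irreducible closed `P′ ≤ Bk k` (`hBk`): every `P` with `P ≤ closure ((⨆ i, ℂ·ψ̄ᵢ) ⊔ (⨆ k, Bk k))` is one-dimensional or labelled.
(§1 at ★ `isUnitary_rightRegular`, ★ `finrank_lineSubrep`.) [cite: BorelJacquet1979, §4.6] [cite: Dixmier1977, §5.4] -/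
theorem isOneDimensional_or_label_of_le_topologicalClosure_sup {ι κ : Type*} (ψ : ι → 𝒢.AutomorphicCharacter)
    (Bk : κ → ClosedSubrep (𝒢.rightRegular μ)) (Q : DiscreteAutomorphicRep 𝒢 μ → κ → Prop)
    (hQ : ∀ (P P' : DiscreteAutomorphicRep 𝒢 μ) (k : κ), AreUnitarilyEquivalent P.space.toContRep P'.space.toContRep → Q P k → Q P' k)
    (hBk : ∀ (k : κ) (P' : DiscreteAutomorphicRep 𝒢 μ), P'.space ≤ Bk k → Q P' k)
    (P : DiscreteAutomorphicRep 𝒢 μ)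
    (hle : P.space.toSubmodule ≤ ((⨆ i, ((ψ i).lineSubrep μ).toSubmodule) ⊔ ⨆ k, (Bk k).toSubmodule).topologicalClosure) :
    P.IsOneDimensional ∨ ∃ k, Q P k := by
  rcases finrank_eq_one_or_exists_equiv_of_le_topologicalClosure_sup (𝒢.isUnitary_rightRegular μ) (fun i => (ψ i).lineSubrep μ)
      (fun i => (ψ i).finrank_lineSubrep μ) Bk P.space P.irreducible hle with h | ⟨k, P', hP'le, hP'irr, heq⟩
  · exact Or.inl h
  · exact Or.inr ⟨k, hQ ⟨P', hP'irr⟩ P k heq.symm (hBk k ⟨P', hP'irr⟩ hP'le)⟩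

end Automorphic

/-! ## §3 The S8 print at `U(Φ₃)`: character lines `charLine₃` ⊔ `πⁿ`-blocks ⟹ socket #2's disjunction -/

section S8

variable (L : Type) [Field L] [NumberField L] [IsCMField L]
  (μ : Measure (UnitaryGroup.cmDatum L 3 (qsForm L)).automorphicQuotient) [(UnitaryGroup.cmDatum L 3 (qsForm L)).IsAutomorphicMeasure μ]
  (μω : HeckeCharacter L) (hμu : μω.IsUnitary)

/-- **G-side post-closure step, index-keeping form.**  Blocks `Bn : κ → ClosedSubrep` labelled by `ξ : κ → OneDimAutRepH L`, letter `hBn` («every irreducible closed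
`P′ ≤ Bn k` is a `πⁿ(ξ k)`», the content of the recommended socket `sock_S8_res_middleResidue_isPiN`): an irreducible `P ≤ closure ((⨆_ψ charLine₃ ψ) ⊔ (⨆_k Bn k))` is
one-dimensional or `IsPiN P μω hμu (ξ k)` for a block it meets (★ #9 `isPiN_of_areUnitarilyEquivalent` transports the label; `charLine₃` unfolds to ★ `lineSubrep` of
★ `cmDetChar` with the instance seam of B :252–:254). [cite: Rogawski1990, §13.9 p. 229 (i)–(ii)] [cite: Rogawski1990, §12.2 (3) p. 173] -/
theorem isOneDimensional_or_exists_isPiN_of_le_topologicalClosure {κ : Type*} (ξ : κ → OneDimAutRepH L)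
    (Bn : κ → ClosedSubrep ((UnitaryGroup.cmDatum L 3 (qsForm L)).rightRegular μ))
    (hBn : ∀ (k : κ) (P' : DiscreteAutomorphicRep (UnitaryGroup.cmDatum L 3 (qsForm L)) μ), P'.space ≤ Bn k → IsPiN P' μω hμu (ξ k))
    (P : DiscreteAutomorphicRep (UnitaryGroup.cmDatum L 3 (qsForm L)) μ)
    (hle : P.space.toSubmodule ≤
      ((⨆ ψ : {ψ : ↥(TorusDict.torus (IsCMField.complexConj L)) →ₜ* ℂˣ // TorusDict.IsAutomorphic (IsCMField.complexConj L) ψ}, (charLine₃ L ψ.1 ψ.2 μ).toSubmodule) ⊔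
        ⨆ k, (Bn k).toSubmodule).topologicalClosure) :
    P.IsOneDimensional ∨ ∃ k, IsPiN P μω hμu (ξ k) :=
  haveI : (adelicGroupData (↥(maximalRealSubfield L)) L (IsCMField.complexConj L) 3 (qsForm L)).IsAutomorphicMeasure μ :=
    ‹(UnitaryGroup.cmDatum L 3 (qsForm L)).IsAutomorphicMeasure μ›
  isOneDimensional_or_label_of_le_topologicalClosure_sup
    (fun ψ : {ψ : ↥(TorusDict.torus (IsCMField.complexConj L)) →ₜ* ℂˣ // TorusDict.IsAutomorphic (IsCMField.complexConj L) ψ} =>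
      cmDetChar L 3 (qsForm L) ψ.1 ψ.2 (isUnit_antidiagOne_det L 3).ne_zero)
    Bn (fun P k => IsPiN P μω hμu (ξ k)) (fun P P' k h hP => isPiN_of_areUnitarilyEquivalent L μ P P' μω hμu (ξ k) h hP) hBn P hle

/-- **Socket #2's consequent VERBATIM** (`P.IsOneDimensional ∨ ∃ ξ : OneDimAutRepH L, IsPiN P μω hμu ξ`) from the closed-span statement and the block letter.
[cite: Rogawski1990, §13.9 p. 229 (i)–(ii)] -/
theorem isOneDimensional_or_exists_isPiN {κ : Type*} (ξ : κ → OneDimAutRepH L)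
    (Bn : κ → ClosedSubrep ((UnitaryGroup.cmDatum L 3 (qsForm L)).rightRegular μ))
    (hBn : ∀ (k : κ) (P' : DiscreteAutomorphicRep (UnitaryGroup.cmDatum L 3 (qsForm L)) μ), P'.space ≤ Bn k → IsPiN P' μω hμu (ξ k))
    (P : DiscreteAutomorphicRep (UnitaryGroup.cmDatum L 3 (qsForm L)) μ)
    (hle : P.space.toSubmodule ≤
      ((⨆ ψ : {ψ : ↥(TorusDict.torus (IsCMField.complexConj L)) →ₜ* ℂˣ // TorusDict.IsAutomorphic (IsCMField.complexConj L) ψ}, (charLine₃ L ψ.1 ψ.2 μ).toSubmodule) ⊔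
        ⨆ k, (Bn k).toSubmodule).topologicalClosure) :
    P.IsOneDimensional ∨ ∃ ξ' : OneDimAutRepH L, IsPiN P μω hμu ξ' :=
  (isOneDimensional_or_exists_isPiN_of_le_topologicalClosure L μ μω hμu ξ Bn hBn P hle).imp_right fun ⟨k, hk⟩ => ⟨ξ k, hk⟩

/-- **Socket #2♯'s consequent SHAPE**: blocks indexed by the `ξ` satisfying a side predicate `R` (for #2♯: `R ξ = LHalfNeZero (ξ.bcη⁻¹ * μω)`) ⟹
`P.IsOneDimensional ∨ ∃ ξ, IsPiN P μω hμu ξ ∧ R ξ`. [cite: Rogawski1990, §13.9 p. 229 (ii)] -/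
theorem isOneDimensional_or_exists_isPiN_and (R : OneDimAutRepH L → Prop)
    (Bn : {ξ : OneDimAutRepH L // R ξ} → ClosedSubrep ((UnitaryGroup.cmDatum L 3 (qsForm L)).rightRegular μ))
    (hBn : ∀ (k : {ξ : OneDimAutRepH L // R ξ}) (P' : DiscreteAutomorphicRep (UnitaryGroup.cmDatum L 3 (qsForm L)) μ), P'.space ≤ Bn k → IsPiN P' μω hμu k.1)
    (P : DiscreteAutomorphicRep (UnitaryGroup.cmDatum L 3 (qsForm L)) μ)
    (hle : P.space.toSubmodule ≤
      ((⨆ ψ : {ψ : ↥(TorusDict.torus (IsCMField.complexConj L)) →ₜ* ℂˣ // TorusDict.IsAutomorphic (IsCMField.complexConj L) ψ}, (charLine₃ L ψ.1 ψ.2 μ).toSubmodule) ⊔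
        ⨆ k, (Bn k).toSubmodule).topologicalClosure) :
    P.IsOneDimensional ∨ ∃ ξ : OneDimAutRepH L, IsPiN P μω hμu ξ ∧ R ξ :=
  (isOneDimensional_or_exists_isPiN_of_le_topologicalClosure L μ μω hμu (fun k : {ξ : OneDimAutRepH L // R ξ} => k.1) Bn hBn P hle).imp_right
    fun ⟨k, hk⟩ => ⟨k.1, hk, k.2⟩

end S8

end Summit.HodgeConjecture.HodgeConjecture.R90.S8

end
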